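import Literature.AlgebraicGeometry.Motives.MixedHodgeStructureHodgeTateGradedPieces
import Literature.AlgebraicGeometry.Motives.MixedHodgeExtensionTateByTate
import Mathlib.LinearAlgebra.Matrix.ToLin
import HarnessLib

/-!
# Morphisms between finite direct sums of mixed Hodge structures; morphisms of Tate powers are matrices

Cattani–El Zein–Griffiths–Lê, *Hodge Theory*, Thm. 3.2.18: "The category of mixed Hodge structures is
abelian" — in particular additive: finite direct sums are biproducts, and a morphism `⊕ⱼ Hⱼ → ⊕ᵢ H'ᵢ` is the
matrix of its components. Carlson, *Extensions of mixed Hodge structures* (1980), §2(b) Example: the Tate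
structures are rigid, `Hom(ℚ(a), ℚ(b)) = 0` for `a ≠ b` and `End ℚ(a) = ℚ`. Marcolli, *Feynman motives*,
after (2.49): pure Tate structures `⊕ ℚ(-p)`.

For the direct sum `MixedHodgeStructure.pi` (`Motives/MixedHodgeStructurePi`: `proj`, `single`, `piLift`,
`piDesc`) and the Tate powers `tatePow n m = ℚ(-m)^n` (`Motives/MixedHodgeStructureHodgeTateGradedPieces`):

* §1 the universal properties as bijections `Hom(H₀, ⊕ⱼ Hⱼ) ≃ Πⱼ Hom(H₀, Hⱼ)` (`Hom.piLiftEquiv`) and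
  `Hom(⊕ⱼ Hⱼ, H₀) ≃ Πⱼ Hom(Hⱼ, H₀)` (`Hom.piDescEquiv`); extensionality through projections / inclusions.
* §2 **matrix calculus**: `Hom(⊕ⱼ Hⱼ, ⊕ᵢ H'ᵢ) ≃ Πᵢⱼ Hom(Hⱼ, H'ᵢ)` (`Hom.component`, `Hom.ofComponents`,
  `Hom.componentsEquiv`), `(f x)ᵢ = Σⱼ fᵢⱼ(xⱼ)`, components of a composite = matrix product
  (`component_comp_toLinearMap`), of the identity (`component_id_same / _ne`); a morphism vanishes iff all its
  components do.
* §3 **Tate powers**: `Hom(ℚ(-a)^n, ℚ(-b)^{n'}) = 0` for `a ≠ b` (`Hom.tatePow_eq_zero_of_ne`); for `a = b`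
  EVERY linear map `ℚ^n → ℚ^{n'}` is a morphism (`Hom.tatePowMap`) and
  **`Hom(ℚ(-a)^n, ℚ(-a)^{n'}) ≃ Hom_ℚ(ℚ^n, ℚ^{n'}) ≃ Mat_{n' × n}(ℚ)`** (`tatePowHomEquiv`,
  `tatePowHomEquivMatrix`, `f x = M·x`, composites ↦ products); `ℚ(-a)^n ≅ ℚ(-a)^{n'}` forces `n = n'`.

All statements proved; definitions with bodies (`Equiv`s and morphisms); no named facts, no instances.

## References

* [CattaniElZeinGriffithsLe2014] E. Cattani et al. (eds.), Hodge Theory (2014), Thm. 3.2.18.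
* [Carlson1980] J. A. Carlson, Extensions of mixed Hodge structures (1980), §2(b) Example.
* [Marcolli2009] M. Marcolli, Feynman motives (2010), after (2.49) (held text p0088).
-/

noncomputable section

open scoped TensorProduct
open Module

namespace Literature.AlgebraicGeometry.Motives

namespace MixedHodgeStructure

open HodgeStructure

universe u v v' v'' w w' w''

variable {ι : Type w} [Fintype ι] [DecidableEq ι]
variable {ι' : Type w'} [Fintype ι'] [DecidableEq ι']
variable {ι'' : Type w''} [Fintype ι''] [DecidableEq ι'']
variable {W : ι → Type v} [∀ j, AddCommGroup (W j)] [∀ j, Module ℚ (W j)]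
variable {W' : ι' → Type v'} [∀ i, AddCommGroup (W' i)] [∀ i, Module ℚ (W' i)]
variable {W'' : ι'' → Type v''} [∀ i, AddCommGroup (W'' i)] [∀ i, Module ℚ (W'' i)]
variable {U : Type u} [AddCommGroup U] [Module ℚ U]

namespace Hom

variable {H : ∀ j, MixedHodgeStructure (W j)} {H' : ∀ i, MixedHodgeStructure (W' i)}
  {H'' : ∀ i, MixedHodgeStructure (W'' i)} {H₀ : MixedHodgeStructure U}

/-! ### §1 The universal properties of `⊕ⱼ Hⱼ` as bijections -/

variable (H H₀) in
/-- **Product universal property**: `Hom(H₀, ⊕ⱼ Hⱼ) ≃ Πⱼ Hom(H₀, Hⱼ)`, `f ↦ (projⱼ ∘ f)ⱼ`, inverse `piLift`.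
[cite: CattaniElZeinGriffithsLe2014, Thm. 3.2.18] -/
def piLiftEquiv : (∀ j, Hom H₀ (H j)) ≃ Hom H₀ (pi H) where
  toFun f := piLift H f
  invFun g j := (proj H j).comp g
  left_inv f := funext fun j => proj_comp_piLift f j
  right_inv _ := Hom.ext (LinearMap.ext fun _ => funext fun _ => rfl)

variable (H H₀) in
/-- **Coproduct universal property**: `Hom(⊕ⱼ Hⱼ, H₀) ≃ Πⱼ Hom(Hⱼ, H₀)`, `f ↦ (f ∘ singleⱼ)ⱼ`, inverse `piDesc`.
[cite: CattaniElZeinGriffithsLe2014, Thm. 3.2.18] -/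
def piDescEquiv : (∀ j, Hom (H j) H₀) ≃ Hom (pi H) H₀ where
  toFun g := piDesc H g
  invFun f j := f.comp (single H j)
  left_inv g := funext fun j => piDesc_comp_single g j
  right_inv f := by
    refine Hom.ext (LinearMap.ext fun x => ?_)
    rw [piDesc_toLinearMap_apply]
    simp only [comp_toLinearMap, LinearMap.comp_apply, single_toLinearMap_apply]
    rw [← map_sum, Finset.univ_sum_single]

/-- `piLiftEquiv f = piLift f` (by `rfl`). [cite: CattaniElZeinGriffithsLe2014, Thm. 3.2.18] -/
@[simp] theorem piLiftEquiv_apply (f : ∀ j, Hom H₀ (H j)) : piLiftEquiv H H₀ f = piLift H f := rfl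

/-- `piDescEquiv g = piDesc g` (by `rfl`). [cite: CattaniElZeinGriffithsLe2014, Thm. 3.2.18] -/
@[simp] theorem piDescEquiv_apply (g : ∀ j, Hom (H j) H₀) : piDescEquiv H H₀ g = piDesc H g := rfl

/-- `f = Σⱼ (f ∘ singleⱼ) ∘ projⱼ`: every morphism out of `⊕ⱼ Hⱼ` is `piDesc` of its restrictions.
[cite: CattaniElZeinGriffithsLe2014, Thm. 3.2.18] -/
theorem piDesc_comp_single_self (f : Hom (pi H) H₀) : piDesc H (fun j => f.comp (single H j)) = f :=
  (piDescEquiv H H₀).apply_symm_apply f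

/-- Every morphism into `⊕ⱼ Hⱼ` is `piLift` of its projections. [cite: CattaniElZeinGriffithsLe2014, Thm. 3.2.18] -/
theorem piLift_proj_comp_self (g : Hom H₀ (pi H)) : piLift H (fun j => (proj H j).comp g) = g :=
  (piLiftEquiv H H₀).apply_symm_apply g

/-- **Extensionality through the projections.** [cite: CattaniElZeinGriffithsLe2014, Thm. 3.2.18] -/
theorem pi_ext_right {f g : Hom H₀ (pi H)} (h : ∀ j, (proj H j).comp f = (proj H j).comp g) : f = g :=
  (piLiftEquiv H H₀).symm.injective (funext h)

/-- **Extensionality through the inclusions.** [cite: CattaniElZeinGriffithsLe2014, Thm. 3.2.18] -/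
theorem pi_ext_left {f g : Hom (pi H) H₀} (h : ∀ j, f.comp (single H j) = g.comp (single H j)) : f = g :=
  (piDescEquiv H H₀).symm.injective (funext h)

/-! ### §2 Matrix calculus for morphisms `⊕ⱼ Hⱼ → ⊕ᵢ H'ᵢ` -/

/-- **The `(i, j)` component `projᵢ ∘ f ∘ singleⱼ : Hⱼ → H'ᵢ`** of a morphism of direct sums.
[cite: CattaniElZeinGriffithsLe2014, Thm. 3.2.18] -/
def component (f : Hom (pi H) (pi H')) (i : ι') (j : ι) : Hom (H j) (H' i) :=
  (proj H' i).comp (f.comp (single H j))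

/-- `fᵢⱼ(x) = f(singleⱼ x)ᵢ` (by `rfl`). [cite: CattaniElZeinGriffithsLe2014, Thm. 3.2.18] -/
@[simp]
theorem component_toLinearMap_apply (f : Hom (pi H) (pi H')) (i : ι') (j : ι) (x : W j) :
    (component f i j).toLinearMap x = f.toLinearMap (Pi.single j x) i := rfl

variable (H H') in
/-- **The morphism `⊕ⱼ Hⱼ → ⊕ᵢ H'ᵢ` with prescribed components** `gᵢⱼ : Hⱼ → H'ᵢ`, `x ↦ (Σⱼ gᵢⱼ xⱼ)ᵢ`.
[cite: CattaniElZeinGriffithsLe2014, Thm. 3.2.18] -/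
def ofComponents (g : ∀ i j, Hom (H j) (H' i)) : Hom (pi H) (pi H') :=
  piLift H' fun i => piDesc H fun j => g i j

/-- `(ofComponents g x)ᵢ = Σⱼ gᵢⱼ(xⱼ)`. [cite: CattaniElZeinGriffithsLe2014, Thm. 3.2.18] -/
theorem ofComponents_toLinearMap_apply (g : ∀ i j, Hom (H j) (H' i)) (x : ∀ j, W j) (i : ι') :
    (ofComponents H H' g).toLinearMap x i = ∑ j, (g i j).toLinearMap (x j) := by
  rw [ofComponents, piLift_toLinearMap_apply, piDesc_toLinearMap_apply]

/-- **`(f x)ᵢ = Σⱼ fᵢⱼ(xⱼ)`.** [cite: CattaniElZeinGriffithsLe2014, Thm. 3.2.18] -/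
theorem toLinearMap_apply_eq_sum_component (f : Hom (pi H) (pi H')) (x : ∀ j, W j) (i : ι') :
    f.toLinearMap x i = ∑ j, (component f i j).toLinearMap (x j) := by
  simp only [component_toLinearMap_apply]
  rw [← Finset.sum_apply, ← map_sum, Finset.univ_sum_single]

/-- The components of `ofComponents g` are the `gᵢⱼ`. [cite: CattaniElZeinGriffithsLe2014, Thm. 3.2.18] -/
@[simp]
theorem component_ofComponents (g : ∀ i j, Hom (H j) (H' i)) (i : ι') (j : ι) :
    component (ofComponents H H' g) i j = g i j :=
  Hom.ext (LinearMap.ext fun x =>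
    congrArg (fun h : Hom (H j) (H' i) => h.toLinearMap x) (piDesc_comp_single (fun k => g i k) j))

/-- A morphism of direct sums is `ofComponents` of its components. [cite: CattaniElZeinGriffithsLe2014, Thm. 3.2.18] -/
@[simp]
theorem ofComponents_component (f : Hom (pi H) (pi H')) : ofComponents H H' (component f) = f :=
  Hom.ext (LinearMap.ext fun x => funext fun i => by
    rw [ofComponents_toLinearMap_apply, toLinearMap_apply_eq_sum_component])

variable (H H') in
/-- **`Hom(⊕ⱼ Hⱼ, ⊕ᵢ H'ᵢ) ≃ Πᵢⱼ Hom(Hⱼ, H'ᵢ)`**: a morphism of finite direct sums of mixed Hodge structures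
is the matrix of its components. [cite: CattaniElZeinGriffithsLe2014, Thm. 3.2.18] -/
def componentsEquiv : Hom (pi H) (pi H') ≃ ∀ i j, Hom (H j) (H' i) where
  toFun := component
  invFun := ofComponents H H'
  left_inv := ofComponents_component
  right_inv g := funext fun i => funext fun j => component_ofComponents g i j

/-- `componentsEquiv f i j = component f i j` (by `rfl`). [cite: CattaniElZeinGriffithsLe2014, Thm. 3.2.18] -/
@[simp] theorem componentsEquiv_apply (f : Hom (pi H) (pi H')) : componentsEquiv H H' f = component f := rfl

/-- **A morphism of direct sums vanishes iff all its components vanish.** [cite: CattaniElZeinGriffithsLe2014, Thm. 3.2.18] -/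
theorem eq_zero_iff_forall_component_eq_zero (f : Hom (pi H) (pi H')) :
    f = Hom.zero _ _ ↔ ∀ i j, component f i j = Hom.zero _ _ := by
  constructor
  · rintro rfl i j
    exact Hom.ext (LinearMap.ext fun x => rfl)
  · intro h
    refine Hom.ext (LinearMap.ext fun x => funext fun i => ?_)
    rw [toLinearMap_apply_eq_sum_component]
    refine (Finset.sum_eq_zero fun j _ => ?_).trans rfl
    rw [h i j]
    rfl

/-- **Components of a composite are matrix products**: `(f' ∘ f)ᵢₖ = Σⱼ f'ᵢⱼ ∘ fⱼₖ`.
[cite: CattaniElZeinGriffithsLe2014, Thm. 3.2.18] -/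
theorem component_comp_toLinearMap (f' : Hom (pi H') (pi H'')) (f : Hom (pi H) (pi H')) (i : ι'') (k : ι) :
    (component (f'.comp f) i k).toLinearMap =
      ∑ j, (component f' i j).toLinearMap ∘ₗ (component f j k).toLinearMap := by
  refine LinearMap.ext fun x => ?_
  rw [LinearMap.sum_apply, component_toLinearMap_apply, comp_toLinearMap, LinearMap.comp_apply,
    toLinearMap_apply_eq_sum_component]
  rfl

/-- Diagonal components of the identity are identities. [cite: CattaniElZeinGriffithsLe2014, Thm. 3.2.18] -/
theorem component_id_same (j : ι) : component (Hom.id (pi H)) j j = Hom.id (H j) := by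
  rw [← proj_comp_single_same (H := H) j]
  rfl

/-- Off-diagonal components of the identity vanish. [cite: CattaniElZeinGriffithsLe2014, Thm. 3.2.18] -/
theorem component_id_ne {i j : ι} (hij : i ≠ j) : component (Hom.id (pi H)) i j = Hom.zero (H j) (H i) := by
  rw [← proj_comp_single_ne (H := H) hij]
  rfl

/-- Components of `single j` and `proj i`: `projᵢ ∘ singleⱼ` is `id` or `0`. [cite: CattaniElZeinGriffithsLe2014, Thm. 3.2.18] -/
theorem proj_comp_single_toLinearMap_apply (i j : ι) (x : W j) :
    ((proj H i).comp (single H j)).toLinearMap x = Pi.single (M := W) j x i := rfl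

end Hom

/-! ### §3 Morphisms between Tate powers `ℚ(-a)^n` -/

section TatePow

variable {n n' n'' : ℕ}

/-- **`Hom(ℚ(-a)^n, ℚ(-b)^{n'}) = 0` for `a ≠ b`** (every component is a morphism `ℚ(-a) → ℚ(-b)`, zero by
rigidity of the Tate structures). [cite: Carlson1980, §2(b) Example] -/
theorem Hom.tatePow_eq_zero_of_ne {a b : ℤ} (hab : a ≠ b) (f : Hom (tatePow n a) (tatePow n' b)) :
    f = Hom.zero _ _ :=
  (Hom.eq_zero_iff_forall_component_eq_zero
    (H := fun _ : Fin n => (tate (-a)).toMixedHodgeStructure)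
    (H' := fun _ : Fin n' => (tate (-b)).toMixedHodgeStructure) f).2 fun _ _ => Hom.tate_eq_zero_of_ne hab _

/-- **Every `ℚ`-linear map `ℚ^n → ℚ^{n'}` is a morphism `ℚ(-a)^n → ℚ(-a)^{n'}`** (both sides are pure of the
single type `(a, a)`). [cite: Marcolli2009, (2.49)] -/
def Hom.tatePowMap (a : ℤ) (φ : (Fin n → ℚ) →ₗ[ℚ] (Fin n' → ℚ)) : Hom (tatePow n a) (tatePow n' a) :=
  Hom.ofTatePow a φ (tatePow_W_of_le n' le_rfl) (tatePow_F_of_le n' le_rfl)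

/-- Underlying map of `Hom.tatePowMap` (by `rfl`). [cite: Marcolli2009, (2.49)] -/
@[simp]
theorem Hom.tatePowMap_toLinearMap (a : ℤ) (φ : (Fin n → ℚ) →ₗ[ℚ] (Fin n' → ℚ)) :
    (Hom.tatePowMap a φ).toLinearMap = φ := rfl

/-- **`Hom(ℚ(-a)^n, ℚ(-a)^{n'}) ≃ Hom_ℚ(ℚ^n, ℚ^{n'})`**: morphisms of pure Tate structures of the same weight
are exactly the linear maps. [cite: Carlson1980, §2(b) Example] -/
def tatePowHomEquiv (n n' : ℕ) (a : ℤ) : Hom (tatePow n a) (tatePow n' a) ≃ ((Fin n → ℚ) →ₗ[ℚ] (Fin n' → ℚ)) where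
  toFun f := f.toLinearMap
  invFun φ := Hom.tatePowMap a φ
  left_inv _ := Hom.ext rfl
  right_inv _ := rfl

/-- `tatePowHomEquiv f = f.toLinearMap` (by `rfl`). [cite: Carlson1980, §2(b) Example] -/
@[simp] theorem tatePowHomEquiv_apply (a : ℤ) (f : Hom (tatePow n a) (tatePow n' a)) :
    tatePowHomEquiv n n' a f = f.toLinearMap := rfl

/-- **`Hom(ℚ(-a)^n, ℚ(-a)^{n'}) ≃ Mat_{n' × n}(ℚ)`**, the matrix of the underlying linear map in the standard
bases. [cite: Carlson1980, §2(b) Example] -/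
def tatePowHomEquivMatrix (n n' : ℕ) (a : ℤ) : Hom (tatePow n a) (tatePow n' a) ≃ Matrix (Fin n') (Fin n) ℚ :=
  (tatePowHomEquiv n n' a).trans LinearMap.toMatrix'.toEquiv

/-- `tatePowHomEquivMatrix f = toMatrix' f.toLinearMap` (by `rfl`). [cite: Carlson1980, §2(b) Example] -/
theorem tatePowHomEquivMatrix_apply (a : ℤ) (f : Hom (tatePow n a) (tatePow n' a)) :
    tatePowHomEquivMatrix n n' a f = LinearMap.toMatrix' f.toLinearMap := rfl

/-- The matrix entries are the scalars of the components: `M(f)ᵢⱼ = fᵢⱼ(1)` where `fᵢⱼ : ℚ(-a) → ℚ(-a)` is the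
`(i, j)` component. [cite: Carlson1980, §2(b) Example] -/
theorem tatePowHomEquivMatrix_apply_eq_component (a : ℤ) (f : Hom (tatePow n a) (tatePow n' a)) (i : Fin n')
    (j : Fin n) :
    tatePowHomEquivMatrix n n' a f i j =
      (Hom.component (H := fun _ : Fin n => (tate (-a)).toMixedHodgeStructure)
        (H' := fun _ : Fin n' => (tate (-a)).toMixedHodgeStructure) f i j).toLinearMap 1 := rfl

/-- **`f(x) = M(f) · x`.** [cite: Carlson1980, §2(b) Example] -/
theorem Hom.tatePow_toLinearMap_eq_mulVec (a : ℤ) (f : Hom (tatePow n a) (tatePow n' a)) (x : Fin n → ℚ) :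
    f.toLinearMap x = Matrix.mulVec (tatePowHomEquivMatrix n n' a f) x := by
  rw [tatePowHomEquivMatrix_apply, LinearMap.toMatrix'_mulVec]

/-- **Composition of morphisms of Tate powers is matrix multiplication.** [cite: Carlson1980, §2(b) Example] -/
theorem tatePowHomEquivMatrix_comp (a : ℤ) (f' : Hom (tatePow n' a) (tatePow n'' a)) (f : Hom (tatePow n a) (tatePow n' a)) :
    tatePowHomEquivMatrix n n'' a (f'.comp f) = tatePowHomEquivMatrix n' n'' a f' * tatePowHomEquivMatrix n n' a f := by
  rw [tatePowHomEquivMatrix_apply, tatePowHomEquivMatrix_apply, tatePowHomEquivMatrix_apply, Hom.comp_toLinearMap,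
    LinearMap.toMatrix'_comp]

/-- The identity corresponds to the identity matrix. [cite: Carlson1980, §2(b) Example] -/
theorem tatePowHomEquivMatrix_id (a : ℤ) : tatePowHomEquivMatrix n n a (Hom.id (tatePow n a)) = 1 := by
  rw [tatePowHomEquivMatrix_apply, Hom.id_toLinearMap, LinearMap.toMatrix'_id]

/-- **`ℚ(-a)^n ≅ ℚ(-a)^{n'}` forces `n = n'`.** [cite: Marcolli2009, (2.49)] -/
theorem eq_of_hom_tatePow_bijective (a : ℤ) (f : Hom (tatePow n a) (tatePow n' a))
    (hf : Function.Bijective f.toLinearMap) : n = n' := by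
  have h := LinearEquiv.finrank_eq (LinearEquiv.ofBijective f.toLinearMap hf)
  rwa [Module.finrank_fin_fun, Module.finrank_fin_fun] at h

/-- `Hom(ℚ(-a)^n, H) ≃ (Hom(ℚ(-a), H))^n`. [cite: CattaniElZeinGriffithsLe2014, Thm. 3.2.18] -/
def tatePowHomLeftEquiv {V : Type u} [AddCommGroup V] [Module ℚ V] (n : ℕ) (a : ℤ) (H : MixedHodgeStructure V) :
    Hom (tatePow n a) H ≃ (Fin n → Hom (tate (-a)).toMixedHodgeStructure H) :=
  (Hom.piDescEquiv (fun _ : Fin n => (tate (-a)).toMixedHodgeStructure) H).symm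

/-- `Hom(H, ℚ(-a)^n) ≃ (Hom(H, ℚ(-a)))^n`. [cite: CattaniElZeinGriffithsLe2014, Thm. 3.2.18] -/
def tatePowHomRightEquiv {V : Type u} [AddCommGroup V] [Module ℚ V] (n : ℕ) (a : ℤ) (H : MixedHodgeStructure V) :
    Hom H (tatePow n a) ≃ (Fin n → Hom H (tate (-a)).toMixedHodgeStructure) :=
  (Hom.piLiftEquiv (fun _ : Fin n => (tate (-a)).toMixedHodgeStructure) H).symm

end TatePow

end MixedHodgeStructure

end Literature.AlgebraicGeometry.Motives
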